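import Literature.Barriers.AtomisticToContinuum.HalfFillingDischarges
import Literature.MathematicalPhysics.QuantumLattice.DuhamelTwoPoint
import HarnessLib

/-!
# Hard-core lattice bosons at half filling: discharge of the energy bound (Dᵀ)

`Literature/Barriers/AtomisticToContinuum`; sibling proof file of `HalfFillingThermalKLS.lean`
(item `provefact-Literature.Barriers.AtomisticToContinuum.HalfFillingReflectionPositivity`). No statement
is introduced or changed; this file discharges the named fact (Dᵀ)
`hc_bondCorr_lower_thermal` of the thermal Kennedy–Lieb–Shastry architecture for the Gibbs state
of the hard-core lattice gas `H = H_XY + λF`, `H_XY = -Σ_{⟨xy⟩}(S¹_xS¹_y + S²_xS²_y)`,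
`F = Σ_x (½ + (-1)^x S³_x)` ([LSSY2005] (11.2)):

`e₁ ≥ 1/8 - λ/(4d) - log 2/(2dβ)` for `d ≥ 1`, `L ≥ 3`, `β > 0`, `λ ≥ 0`.

Proof ([KLS1988PRL] after eq. (8), "a simple variational argument", at positive temperature):
* `⟨H_XY⟩_β = -2 Σ_E G¹(e)` (edge by edge, by (Sᵀ) `G² = G¹` and the symmetry of `G¹`), and
  `⟨H_XY⟩_β ≤ ⟨H⟩_β` because `F ≥ 0` (`½ ± S³ ≥ 0` for spin ½) and `λ ≥ 0`;
* the energy–entropy bound `⟨H⟩_β ≤ ⟨ψ, Hψ⟩ + log(dim)/β` for every unit vector `ψ`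
  (`Matrix.re_gibbsState_hamiltonian_le` of `DuhamelTwoPoint.lean` at a minimal eigenvalue, and the
  variational principle), `dim = 2^{|Λ|}`;
* the product state with all spins along the `1`-axis has `⟨ψ, H_XY ψ⟩ = -¼|E|`
  (`xyTorus_trialEnergy`) and `⟨ψ, F ψ⟩ = ½|Λ|` (`⟨+|S³|+⟩ = 0`);
* sums over site–direction pairs are sums over edges for `L ≥ 3`, and `d L^d = |E|`
  (`sum_pairs_eq_sum_edgeFinset`).

## References

* [KLS1988PRL] T. Kennedy, E. H. Lieb, B. S. Shastry, Phys. Rev. Lett. 61 (1988) 2582, after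
  eq. (8).
* [LSSY2005] E. H. Lieb, R. Seiringer, J. P. Solovej, J. Yngvason, *The Mathematics of the Bose
  Gas and its Condensation* (2005), Ch. 11, (11.2).
-/

noncomputable section

open Filter Topology Matrix Finset
open Literature.MathematicalPhysics.QuantumLattice Literature.MathematicalPhysics.QuantumLattice.SpinOperators
  Literature.Probability.LatticeModels Literature.Probability.Percolation
open scoped ComplexOrder

/-! ### The energy–entropy bound against a trial vector -/

namespace Matrix

variable {m : Type*} [Fintype m] [DecidableEq m]

/-- **Energy–entropy bound, variational form**: `⟨H⟩_β ≤ ⟨ψ, Hψ⟩ + log(dim)/β` for Hermitian `H`,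
`β > 0` and every unit vector `ψ` (`Matrix.re_gibbsState_hamiltonian_le` at a minimal eigenvalue,
which is the ground energy, and the variational principle `E₀ ≤ ⟨ψ, Hψ⟩`). [folklore] -/
theorem re_gibbsState_hamiltonian_le_rayleigh {H : Matrix m m ℂ} (hH : H.IsHermitian) {β : ℝ}
    (hβ : 0 < β) (ψ : m → ℂ) (hψ : star ψ ⬝ᵥ ψ = 1) :
    (gibbsState β H H).re ≤ (star ψ ⬝ᵥ H *ᵥ ψ).re + Real.log (Fintype.card m) / β := by
  rcases isEmpty_or_nonempty m with hm | hm
  · simp [dotProduct] at hψ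
  obtain ⟨i₀, hi₀⟩ := Finite.exists_min hH.eigenvalues
  have h1 := re_gibbsState_hamiltonian_le hH hβ i₀
  have h2 : hH.eigenvalues i₀ ≤ H.groundEnergy := by
    rw [groundEnergy_eq_iInf_eigenvalues_holds hH]
    exact le_ciInf hi₀
  have h3 := groundEnergy_le_rayleigh_holds hH ψ hψ
  linarith

end Matrix

namespace Literature.MathematicalPhysics.QuantumLattice

variable {Λ : Type*} [Fintype Λ] [DecidableEq Λ]

/-- Diagonal entries of a single-site operator in a basis state: `⟨σ| a_x |σ⟩ = a_{σ_x σ_x}`.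
[folklore] -/
theorem onSite_apply_self {q : ℕ} (x : Λ) (a : Matrix (Fin q) (Fin q) ℂ) (σ : TensorIndex Λ q) :
    (onSite x a : Op Λ q) σ σ = a (σ x) (σ x) := by
  rw [onSite_apply, if_pos fun _ _ => rfl]

/-- `Sˣ` has zero diagonal: `⟨k| Sˣ |k⟩ = 0`. [folklore] -/
theorem spinX_apply_self (n : ℕ) (k : Fin (n + 1)) : spinX n k k = 0 := by
  have h : spinRaise n k k = 0 := by rw [spinRaise_apply, if_neg (by omega)]
  rw [spinX, Matrix.smul_apply, Matrix.add_apply, spinLower_eq_conjTranspose, conjTranspose_apply,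
    h, star_zero, add_zero, smul_zero]

end Literature.MathematicalPhysics.QuantumLattice

namespace Literature.Barriers.AtomisticToContinuum.BoseGas

variable {d : ℕ}

/-! ### Gibbs expectations of bond operators and of the XY energy -/

/-- Real part of the Gibbs state on a symmetrised bond: `Re ⟨½(Sᵅ_x Sᵅ_y + Sᵅ_y Sᵅ_x)⟩_β = G^α(x,y)`.
[folklore] -/
theorem re_gibbsState_spinBond (β : ℝ) (L : ℕ) [NeZero L] (lam : ℝ) (α : Fin 3)
    (x y : TorusSite d L) :
    (gibbsState β (hardCoreLatticeGas d L lam) (spinBond 1 α x y)).re = hcCorr α β L lam x y := by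
  have hs := hcCorr_symm α β L lam y x
  rw [hcCorr_of_neZero, hcCorr_of_neZero, thermalCorr, thermalCorr] at hs
  rw [spinBond, LinearMap.map_smul, map_add, smul_eq_mul,
    show (1 / 2 : ℂ) = ((1 / 2 : ℝ) : ℂ) by push_cast; ring, Complex.re_ofReal_mul,
    Complex.add_re, hcCorr_of_neZero, thermalCorr, hs]
  ring

/-- **The thermal XY energy, edge by edge**: `Re ⟨H_XY⟩_β = -2 Σ_{e ∈ E} G¹(e)` in the Gibbs state
of the hard-core lattice gas (by (Sᵀ) `G² = G¹` and the symmetry of `G¹`).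
[cite: KLS1988PRL, eq. (1)] -/
theorem re_gibbsState_xyTorus (β : ℝ) (L : ℕ) [NeZero L] (lam : ℝ) :
    (gibbsState β (hardCoreLatticeGas d L lam) (xyTorus d L 1)).re =
      -2 * ∑ e ∈ (torusGraph d L).edgeFinset, Sym2.lift
        ⟨fun x y => hcCorr 0 β L lam x y, fun x y => hcCorr_symm 0 β L lam x y⟩ e := by
  have hS : ∀ x y : TorusSite d L, hcCorr 1 β L lam x y = hcCorr 0 β L lam x y :=
    fun x y => hc_corr_one_eq_zero_holds d L β lam x y
  have key : ∀ x y : TorusSite d L, (gibbsState β (hardCoreLatticeGas d L lam)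
      (spinBond 1 0 x y + spinBond 1 1 x y + ((0 : ℝ) : ℂ) • spinBond 1 2 x y)).re =
      2 * hcCorr 0 β L lam x y := by
    intro x y
    rw [map_add, map_add, Complex.add_re, Complex.add_re, re_gibbsState_spinBond,
      re_gibbsState_spinBond, LinearMap.map_smul, Complex.ofReal_zero, zero_smul,
      Complex.zero_re, add_zero, hS]
    ring
  rw [show gibbsState β (hardCoreLatticeGas d L lam) (xyTorus d L 1) =
    gibbsState β (hardCoreLatticeGas d L lam) (((-1 : ℝ) : ℂ) •
      ∑ e ∈ (torusGraph d L).edgeFinset,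
      Sym2.lift ⟨fun x y => spinBond 1 0 x y + spinBond 1 1 x y + ((0 : ℝ) : ℂ) • spinBond 1 2 x y,
        fun x y => by simp only [spinBond_comm]⟩ e) from rfl]
  rw [LinearMap.map_smul, map_sum, smul_eq_mul, Complex.re_ofReal_mul, Complex.re_sum, neg_mul,
    one_mul, neg_mul, neg_inj, mul_sum]
  refine sum_congr rfl fun e _ => ?_
  induction e using Sym2.ind with
  | h x y => rw [Sym2.lift_mk, Sym2.lift_mk, key]

/-- **The staggered field is nonnegative in expectation**: `Re ⟨Σ_x (½ + (-1)^x S³_x)⟩_β ≥ 0`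
(`½ ± S³_x ≥ 0` for spin ½, positivity of the Gibbs state). [folklore] -/
theorem re_gibbsState_staggeredField_nonneg (β : ℝ) (L : ℕ) [NeZero L] (lam : ℝ) :
    0 ≤ (gibbsState β (hardCoreLatticeGas d L lam) (∑ x : TorusSite d L,
      ((1 / 2 : ℂ) • (1 : Op (TorusSite d L) 2) +
        ((-1 : ℂ) ^ (∑ i, (x i).val)) • siteSpin 1 x 2))).re := by
  rw [map_sum, Complex.re_sum]
  refine sum_nonneg fun x _ => ?_
  have hH := hardCoreLatticeGas_isHermitian d L lam
  have hpsd : Matrix.PosSemidef ((1 / 2 : ℂ) • (1 : Op (TorusSite d L) 2) +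
      ((-1 : ℂ) ^ (∑ i, (x i).val)) • siteSpin 1 x 2) := by
    have h12 : (1 / 2 : ℂ) = ((1 : ℕ) : ℂ) / 2 := by push_cast; ring
    rcases neg_one_pow_eq_or ℂ (∑ i, (x i).val) with h | h
    · rw [h, one_smul, h12]
      exact posSemidef_smul_one_add_siteSpin 1 x 2
    · rw [h, neg_one_smul, ← sub_eq_add_neg, h12]
      exact posSemidef_smul_one_sub_siteSpin 1 x 2
  exact (Complex.nonneg_iff.mp (gibbsState_nonneg_of_posSemidef β hH hpsd)).1

/-- `Re ⟨H_XY⟩_β ≤ Re ⟨H⟩_β` for `λ ≥ 0` (`H = H_XY + λF`, `F ≥ 0`). [cite: LSSY2005, Ch. 11 (11.2)] -/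
theorem re_gibbsState_xyTorus_le (β : ℝ) (L : ℕ) [NeZero L] {lam : ℝ} (hlam : 0 ≤ lam) :
    (gibbsState β (hardCoreLatticeGas d L lam) (xyTorus d L 1)).re ≤
      (gibbsState β (hardCoreLatticeGas d L lam) (hardCoreLatticeGas d L lam)).re := by
  have h := re_gibbsState_staggeredField_nonneg (d := d) β L lam
  set H := hardCoreLatticeGas d L lam with hH
  rw [show gibbsState β H H = gibbsState β H (xyTorus d L 1 + (lam : ℂ) • ∑ x : TorusSite d L,
      ((1 / 2 : ℂ) • (1 : Op (TorusSite d L) 2) + ((-1 : ℂ) ^ (∑ i, (x i).val)) • siteSpin 1 x 2))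
      from rfl, map_add, Complex.add_re, LinearMap.map_smul, smul_eq_mul, Complex.re_ofReal_mul]
  exact le_add_of_nonneg_right (mul_nonneg hlam h)

/-! ### The trial state: all spins along the `1`-axis -/

/-- **The trial energy of the hard-core lattice gas**: for a unitary `V` with `V Sᶻ Vᴴ = Sˣ`,
`V Sˣ Vᴴ = -Sᶻ`, `V Sʸ Vᴴ = Sʸ`, the rotated basis state `(⨂V)|0…0⟩` (all spins `S¹ = +½`) has
energy `-¼|E| + ½λ|Λ|` (`⟨+|S³|+⟩ = -⟨0|Sˣ|0⟩ = 0`).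
[cite: KLS1988PRL, after eq. (8)] [cite: LSSY2005, Ch. 11 (11.2)] -/
theorem hardCoreLatticeGas_trialEnergy (L : ℕ) [NeZero L] (lam : ℝ)
    {V : Matrix (Fin 2) (Fin 2) ℂ} (hV : V * Vᴴ = 1) (hV' : Vᴴ * V = 1)
    (hVz : V * SpinOperators.spinZ 1 * Vᴴ = spinX 1) (hVx : V * spinX 1 * Vᴴ = -SpinOperators.spinZ 1)
    (hVy : V * spinY 1 * Vᴴ = spinY 1) :
    (productOp (fun _ : TorusSite d L => Vᴴ) * hardCoreLatticeGas d L lam *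
        (productOp (fun _ : TorusSite d L => Vᴴ))ᴴ) (fun _ => 0) (fun _ => 0) =
      -((1 / 4 : ℂ) * ((torusGraph d L).edgeFinset.card : ℂ)) +
        (lam : ℂ) * ((Fintype.card (TorusSite d L) : ℂ) / 2) := by
  set u : TorusSite d L → Matrix (Fin 2) (Fin 2) ℂ := fun _ => Vᴴ with hu_def
  have hu : ∀ z, u z * (u z)ᴴ = 1 := fun _ => by rw [hu_def, conjTranspose_conjTranspose, hV']
  have hu' : ∀ z, (u z)ᴴ * u z = 1 := fun _ => by rw [hu_def, conjTranspose_conjTranspose, hV]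
  have hz : Vᴴ * SpinOperators.spinZ 1 * V = -spinX 1 := by
    have h : Vᴴ * (V * spinX 1 * Vᴴ) * V = Vᴴ * (-SpinOperators.spinZ 1) * V := by rw [hVx]
    rw [show Vᴴ * (V * spinX 1 * Vᴴ) * V = (Vᴴ * V) * spinX 1 * (Vᴴ * V) by
      simp only [Matrix.mul_assoc], hV', Matrix.one_mul, Matrix.mul_one, Matrix.mul_neg,
      Matrix.neg_mul] at h
    rw [h, neg_neg]
  have hXY := xyTorus_trialEnergy (d := d) L 1 hV hV' hVz hVy
  -- the staggered field, conjugated site by site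
  have hF : productOp u * (∑ x : TorusSite d L, ((1 / 2 : ℂ) • (1 : Op (TorusSite d L) 2) +
      ((-1 : ℂ) ^ (∑ i, (x i).val)) • siteSpin 1 x 2)) * (productOp u)ᴴ =
      ∑ x : TorusSite d L, ((1 / 2 : ℂ) • (1 : Op (TorusSite d L) 2) +
        ((-1 : ℂ) ^ (∑ i, (x i).val)) • onSite x (-spinX 1)) := by
    rw [Finset.mul_sum, Finset.sum_mul]
    refine sum_congr rfl fun x _ => ?_
    rw [Matrix.mul_add, Matrix.add_mul, Matrix.mul_smul, Matrix.smul_mul, Matrix.mul_one,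
      productOp_mul_conjTranspose hu, Matrix.mul_smul, Matrix.smul_mul, siteSpin,
      productOp_conj_onSite hu, spinVec_two, hu_def]
    simp only [conjTranspose_conjTranspose, hz]
  rw [hardCoreLatticeGas_eq, Matrix.mul_add, Matrix.add_mul, Matrix.add_apply, hXY,
    Matrix.mul_smul, Matrix.smul_mul, hF, Matrix.smul_apply, Matrix.sum_apply, smul_eq_mul]
  congr 1
  · push_cast; ring
  · have hterm : ∀ x : TorusSite d L, ((1 / 2 : ℂ) • (1 : Op (TorusSite d L) 2) +
        ((-1 : ℂ) ^ (∑ i, (x i).val)) • onSite x (-spinX 1)) (fun _ => 0) (fun _ => 0) = 1 / 2 := by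
      intro x
      rw [Matrix.add_apply, Matrix.smul_apply, Matrix.one_apply_eq, Matrix.smul_apply,
        onSite_apply_self, Matrix.neg_apply, spinX_apply_self, neg_zero, smul_eq_mul,
        smul_eq_mul, mul_zero, add_zero, mul_one]
    simp only [hterm, sum_const, card_univ, nsmul_eq_mul]
    ring

/-- The dimension of the state space of the hard-core lattice gas: `dim = 2^{|Λ|}`, so
`log dim = |Λ| log 2`. [folklore] -/
theorem log_card_tensorIndex (L : ℕ) [NeZero L] :
    Real.log (Fintype.card (TensorIndex (TorusSite d L) 2)) =
      (Fintype.card (TorusSite d L) : ℝ) * Real.log 2 := by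
  rw [show Fintype.card (TensorIndex (TorusSite d L) 2) = 2 ^ Fintype.card (TorusSite d L) by
    rw [Fintype.card_fun, Fintype.card_fin], Nat.cast_pow, Nat.cast_ofNat, Real.log_pow]

/-! ### (Dᵀ) -/

/-- **Discharge of (Dᵀ)** `hc_bondCorr_lower_thermal`: `e₁ ≥ 1/8 - λ/(4d) - log 2/(2dβ)` for
`d ≥ 1`, `L ≥ 3`, `β > 0`, `λ ≥ 0`. Chain: `-2Σ_E G¹ = ⟨H_XY⟩_β ≤ ⟨H⟩_β ≤ ⟨ψ,Hψ⟩ + |Λ| log 2/β`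
with the product state `ψ` along the `1`-axis, `⟨ψ,Hψ⟩ = -¼|E| + ½λ|Λ|`, and `|E| = d|Λ|`,
`Σ_xΣᵢ G¹(x,x+eᵢ) = Σ_E G¹` for `L ≥ 3`. [cite: KLS1988PRL, after eq. (8)]
[cite: LSSY2005, Ch. 11 (11.2)] -/
theorem hc_bondCorr_lower_thermal_holds : hc_bondCorr_lower_thermal := by
  intro d hd L hL β lam hβ hlam
  haveI : NeZero L := ⟨by omega⟩
  set E := (torusGraph d L).edgeFinset with hE
  set g : Sym2 (TorusSite d L) → ℝ :=
    Sym2.lift ⟨fun x y => hcCorr 0 β L lam x y, fun x y => hcCorr_symm 0 β L lam x y⟩ with hg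
  set H := hardCoreLatticeGas d L lam with hH
  have hHerm : H.IsHermitian := hardCoreLatticeGas_isHermitian d L lam
  -- (1) `⟨H_XY⟩ = -2 Σ_E g ≤ ⟨H⟩`
  have h1 : -2 * ∑ e ∈ E, g e ≤ (gibbsState β H H).re := by
    rw [← re_gibbsState_xyTorus]
    exact re_gibbsState_xyTorus_le β L hlam
  -- (2) the trial state
  obtain ⟨V, hV, hV', hVz, hVx, hVy⟩ := exists_unitary_conj_spinZ_eq_spinX 1
  set W : Op (TorusSite d L) 2 := productOp (fun _ : TorusSite d L => Vᴴ) with hW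
  have hWW : W * Wᴴ = 1 :=
    productOp_mul_conjTranspose fun _ => by rw [conjTranspose_conjTranspose, hV']
  set v : TensorIndex (TorusSite d L) 2 → ℂ := Pi.single (fun _ => 0) 1 with hv
  have hstar : star v = v := by rw [hv, ← Pi.single_star, star_one]
  have hψ : star (Wᴴ *ᵥ v) ⬝ᵥ (Wᴴ *ᵥ v) = 1 := by
    rw [star_mulVec, conjTranspose_conjTranspose, ← dotProduct_mulVec, mulVec_mulVec, hWW,
      one_mulVec, hstar, hv, single_dotProduct, Pi.single_eq_same, one_mul]
  have h2 := Matrix.re_gibbsState_hamiltonian_le_rayleigh hHerm hβ (Wᴴ *ᵥ v) hψ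
  rw [star_mulVec, conjTranspose_conjTranspose, ← dotProduct_mulVec, mulVec_mulVec,
    mulVec_mulVec, hstar, hv, single_dotProduct, one_mul, mulVec_single_one, Matrix.col_apply, hW,
    hH, hardCoreLatticeGas_trialEnergy L lam hV hV' hVz hVx hVy, log_card_tensorIndex,
    show -((1 / 4 : ℂ) * (E.card : ℂ)) + (lam : ℂ) * ((Fintype.card (TorusSite d L) : ℂ) / 2) =
      ((-((1 / 4 : ℝ) * (E.card : ℝ)) + lam * ((Fintype.card (TorusSite d L) : ℝ) / 2) : ℝ) : ℂ) by
      push_cast; ring, Complex.ofReal_re] at h2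
  -- (3) cardinalities: `|Λ| = L^d`, `d L^d = |E|`, pairs versus edges
  have hcard : (Fintype.card (TorusSite d L) : ℝ) = (L : ℝ) ^ d := by
    rw [Fintype.card_pi, prod_const, ZMod.card, card_univ, Fintype.card_fin]
    push_cast
    ring
  have hL2 : 2 ≤ L := by omega
  have hL3 : L ≠ 2 := by omega
  have h4 := sum_pairs_eq_sum_edgeFinset L hL2 g
  have h5 := sum_pairs_eq_sum_edgeFinset (d := d) L hL2 (fun _ => (1 : ℝ))
  simp only [sum_const, card_univ, nsmul_eq_mul, mul_one, Fintype.card_fin, if_neg hL3,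
    one_mul] at h5 h4
  -- `h5 : |Λ| * d = |E|`
  rw [hcard] at h5 h2
  rw [hcBondCorr_of_neZero]
  have hg' : ∀ (x : TorusSite d L) (i : Fin d),
      hcCorr 0 β L lam x (x + Pi.single i 1) = g s(x, x + Pi.single i 1) := fun x i => rfl
  simp_rw [hg']
  rw [h4]
  have hLpos : (0 : ℝ) < (L : ℝ) ^ d := by
    have : (0 : ℝ) < L := by exact_mod_cast (show 0 < L by omega)
    positivity
  have hd0 : (0 : ℝ) < d := by exact_mod_cast (show 0 < d by omega)
  have hpos : (0 : ℝ) < (d : ℝ) * (L : ℝ) ^ d := by positivity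
  rw [le_div_iff₀ hpos]
  -- everything is linear now: `|E| = d L^d`
  have hEcard : (E.card : ℝ) = (d : ℝ) * (L : ℝ) ^ d := by rw [← h5]; ring
  rw [hEcard] at h2
  have key : -2 * ∑ e ∈ E, g e ≤
      -((1 / 4 : ℝ) * ((d : ℝ) * (L : ℝ) ^ d)) + lam * ((L : ℝ) ^ d / 2) +
        (L : ℝ) ^ d * Real.log 2 / β := h1.trans h2
  have hdiv : (1 / 8 - lam / (4 * d) - Real.log 2 / (2 * d * β)) * ((d : ℝ) * (L : ℝ) ^ d) =
      (1 / 8) * ((d : ℝ) * (L : ℝ) ^ d) - lam * ((L : ℝ) ^ d / 4) -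
        (L : ℝ) ^ d * Real.log 2 / (2 * β) := by
    field_simp
  rw [hdiv]
  have hlog : (L : ℝ) ^ d * Real.log 2 / β = 2 * ((L : ℝ) ^ d * Real.log 2 / (2 * β)) := by
    field_simp
  rw [hlog] at key
  linarith

end Literature.Barriers.AtomisticToContinuum.BoseGas
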